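import Literature.NumberTheory.Automorphic.OrbitalIntegralLocallyConstantTorus
import Literature.NumberTheory.Automorphic.ConjugationProperOnRegularCompactaLocal
import Literature.NumberTheory.Automorphic.OrbitalIntegralLocallyConstantSubgroupChart
import Literature.NumberTheory.Automorphic.OrbitalMeasureCanonicalExistsCM
import Literature.NumberTheory.Automorphic.UnitaryGroupPureTensorEulerProduct
import Literature.NumberTheory.Rogawski1990.LocalTransferFundamentalLemma
import Literature.LinearAlgebra.Matrix.SeparableCharpolyOpen
import HarnessLib

/-!
# Regular orbital integrals on `U(J)(F_v)` at a non-split place are locally constant along the torus — the CM dress of N6ns-reg (ii) on the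
# carriers `(cmDatum L N J).Local v` ((G1-i) of the (HLOC) junction)

Topic `NumberTheory/Rogawski1990` (§2, the `cmDatum` carriers of the letters) over `NumberTheory/Automorphic` (§1, the matrix carriers
`UnitaryGroup.«local» E c N J v`). THEOREMS ONLY (no definition, no instance, no notation, no named fact, no `sorry`). Cell `pub/hodgecm-mathlib`,
programme P3a, road «N6-ns» (the non-split clause of letter N6), brick «(ii)+(ii′)-CM DRESS» FILE B (LEAD F0P3a-plan (g9) T8-23 (C)(2), T8-25 (B)(G1-i);
p08 (g13) LEDGER cc0e73ef (G1-i); F0P2-p02 (g8)'s torus-form feeder spec 02:43:45Z). Inputs, all ★ and IMPORTED (never restated): (ii)⊕(ii′) generic ★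
`OrbitalIntegralLocallyConstantTorus` (FILE A); (ii′) on `U(J)(F_v)` ★ `ConjugationProperOnRegularCompactaLocal` (A-p03 (g24),
`isCompact_image_mk_setOf_exists_conj_mem_local_of_nonsplit`); the one-place model ★ `localNonsplitEquiv : U(J)(F_v) ≃ₜ* U(σ_w, J_w)(E_w)`; the
regularity bridge ★ `charpoly_separable_localNonsplitEquiv_of_isRegularElt`; the torus measure ★
`forall_isRegularElt_exists_isHaarMeasure_compactCore_centralizer_local_eq_one`; ★ `centralizer_eq_centralizer_of_charpoly_separable`; ★
`Subgroup.isOpen_setOf_charpoly_separable`; `GL_N(E_w)` locally compact ∕ second countable ★ `locallyCompactSpace_gl_adicCompletion` ∕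
`secondCountableTopology_gl_adicCompletion`; ★ `IsLocSmooth`.

THE STATEMENTS. `E ∕ F` a quadratic extension of number fields with non-trivial automorphism `c`, `J ∈ M_N(E)` `c`-hermitian with unit determinant,
`v` a finite place of `F` NON-SPLIT in `E` (`w ∣ v`, `c • w = w`), `G = U(J)(F_v) = «local» E c N J v ≤ GL_N(∏_{w′∣v} E_{w′})`, `γ ∈ G` regular semisimple
(★ `IsRegularElt`: separable characteristic polynomial), `T = Z_G(γ)`, `m` a CANONICAL orbital measure family on the regular classes for the Haar `ν`
(★ `OrbitalMeasureFamily.IsCanonical`, the currency of ★ `exists_isCanonical_cmDatum_local` ∕ ★ `LocalTransferExplicit`).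
* §1.1 `isRegularElt_iff_charpoly_separable_localNonsplitEquiv` (regularity IS separability of the `w`-component), `isOpen_setOf_isRegularElt_local_of_nonsplit`
  (the regular locus is open), `centralizer_eq_centralizer_of_isRegularElt_local_of_nonsplit` (`t ∈ Z(γ)` regular ⇒ `Z(t) = Z(γ)`);
* §1.2 **(ii) TORUS FORM `exists_nhds_classOrbitalIntegral_mk_eq_local_of_nonsplit`**: for EVERY locally constant compactly supported `f : G → V` there is
  `W ∈ 𝓝 γ` with `Φ([t], f; m) = Φ([γ], f; m)` for all `t ∈ W ∩ Z(γ)`; the base-point-free reading `…_of_mem_centralizer` (any regular `t₀ ∈ Z(γ)`) and the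
  subspace-topology reading **`eventually_classOrbitalIntegral_mk_eq_local_of_nonsplit`**: for `ψ ∈ C_c^∞` (★ `IsLocSmooth`) and `t₀ : ↥Z(γ)` regular,
  `∀ᶠ t in 𝓝 t₀, Φ(⟦t⟧, ψ; m) = Φ(⟦t₀⟧, ψ; m)` — «`t ↦ Φ(⟦t⟧, ψ)` is locally constant on `Z(γ)^{reg}`»;
* §2 the CM spellings on `G′_v = (cmDatum L N J).Local v` (`L` CM, `c` = complex conjugation): **`exists_nhds_classOrbitalIntegral_mk_eq_cmDatum_local`**,
  `…_cmDatum_local_of_mem_centralizer`, **`eventually_classOrbitalIntegral_mk_eq_cmDatum_local`** = (G1-i) of F0P2-p02's junction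
  `LocalTransferChartJunctionCM` token-for-token (`∀ ψ, IsLocSmooth ψ → ∀ t₀ : ↥(Subgroup.centralizer {γ₀′}), IsRegularElt (t₀ : G′_v).val → ∀ᶠ t in 𝓝 t₀, …`),
  pulled back there along the torus transport `θ`.
NOT here: split places (the D-N6s road), the Cayley-coordinate form (★ FILE 3 `UnitaryRegularOrbitalIntegralLocallyConstant`, chart-supported `f`), (ii′) itself
(★ A-p03), the H-side chart datum (A-p16), `Δ‴` local constancy (B-p04), the junction (F0P2-p02). HONEST LABEL: HC_CM is proved only modulo the printed
citations until rung 0 closes; this file pays nothing by itself.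

## References
* [HarishChandra1970] Harish-Chandra (notes by G. van Dijk), *Harmonic Analysis on Reductive p-adic Groups*, LNM 162 (1970), Part I §3, Lemmas 13–14.
* [Rogawski1990] J. D. Rogawski, *Automorphic Representations of Unitary Groups in Three Variables*, Ann. of Math. Stud. 123 (1990), §3.1 p. 19; §4.3 (4.3.1) p. 43;
  §4.9 p. 54.
* [PlatonovRapinchuk1994] V. Platonov, A. Rapinchuk, *Algebraic Groups and Number Theory* (1994), §5.1 (`E ⊗_F F_v = E_w` at a non-split place).
* [DeitmarEchterhoff2014] A. Deitmar, S. Echterhoff, *Principles of Harmonic Analysis*, 2nd ed. (2014), Thm. 1.5.3, Lemma 9.3.3.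
-/

set_option autoImplicit false

noncomputable section

open MeasureTheory Measure Set Filter Topology NumberField IsDedekindDomain Polynomial
open Literature.MeasureTheory.Group
open scoped Matrix MatrixGroups

/-! ## §1 `U(J)(F_v) = «local» E c N J v` at a non-split place -/

namespace Literature.NumberTheory.Automorphic.UnitaryGroup

open Literature.NumberTheory.Rogawski1990 (IsRegularElt isRegularElt_iff isRegularElt_of_isConj)

section Nonsplit

variable {F E : Type} [Field F] [NumberField F] [Field E] [NumberField E] [Algebra F E] [Algebra.IsQuadraticExtension F E]
  (c : E ≃ₐ[F] E) (N : ℕ) (J : Matrix (Fin N) (Fin N) E) {v : HeightOneSpectrum (𝓞 F)} (hc : c ≠ 1)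
  (w : PlacesOver E v) (hw : c • w.1 = w.1)

include hc w hw

/-! ### §1.1 Regularity through the one-place model -/

/-- **At a non-split place, regularity IS separability of the `w`-component**: `γ ∈ U(J)(F_v)` is regular semisimple in `GL_N(E ⊗_F F_v)` iff its
one-place image `e γ ∈ U(σ_w, J_w)(E_w)` has separable characteristic polynomial (`E ⊗_F F_v = E_w`: the evaluation at the unique `w ∣ v` is a ring
isomorphism, Mathlib `RingEquiv.piUnique`; `Matrix.charpoly_map`, `Polynomial.Separable.map` both ways; → is ★ `charpoly_separable_localNonsplitEquiv_of_isRegularElt`).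
[cite: Rogawski1990, §3.1 p. 19] [cite: PlatonovRapinchuk1994, §5.1] -/
theorem isRegularElt_iff_charpoly_separable_localNonsplitEquiv (γ : «local» E c N J v) :
    IsRegularElt (γ : GL (Fin N) (LocalRing E v)) ↔
      ((((localNonsplitEquiv c J hc w hw γ : unitaryGroupOfForm (galAdicCompletionMap (L := E) c hw) (placeForm J w.1)) :
        GL (Fin N) (w.1.adicCompletion E)) : Matrix (Fin N) (Fin N) (w.1.adicCompletion E)).charpoly).Separable := by
  refine ⟨charpoly_separable_localNonsplitEquiv_of_isRegularElt c N J hc γ w hw, fun h => ?_⟩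
  haveI : Subsingleton (PlacesOver E v) := PlacesOver.subsingleton_of_smul_eq c hc w hw
  letI : Unique (PlacesOver E v) := uniqueOfSubsingleton w
  have hmat : ((((localNonsplitEquiv c J hc w hw γ : unitaryGroupOfForm (galAdicCompletionMap (L := E) c hw) (placeForm J w.1)) :
        GL (Fin N) (w.1.adicCompletion E)) : Matrix (Fin N) (Fin N) (w.1.adicCompletion E))) =
      ((γ : GL (Fin N) (LocalRing E v)) : Matrix (Fin N) (Fin N) (LocalRing E v)).map
        (Pi.evalRingHom (fun w' : PlacesOver E v => w'.1.adicCompletion E) w) := rfl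
  rw [hmat, Matrix.charpoly_map] at h
  let φ : LocalRing E v ≃+* w.1.adicCompletion E := RingEquiv.piUnique fun w' : PlacesOver E v => w'.1.adicCompletion E
  have hφ : Pi.evalRingHom (fun w' : PlacesOver E v => w'.1.adicCompletion E) w = (φ : LocalRing E v →+* w.1.adicCompletion E) :=
    RingHom.ext fun _ => rfl
  rw [hφ] at h
  have h' := h.map (f := (φ.symm : w.1.adicCompletion E →+* LocalRing E v))
  rw [Polynomial.map_map] at h'
  have hcomp : (φ.symm : w.1.adicCompletion E →+* LocalRing E v).comp (φ : LocalRing E v →+* w.1.adicCompletion E) = RingHom.id _ :=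
    RingHom.ext fun x => φ.symm_apply_apply x
  rw [hcomp, Polynomial.map_id] at h'
  exact h'

/-- **The regular locus of `U(J)(F_v)` is OPEN** at a non-split place (★ `Subgroup.isOpen_setOf_charpoly_separable` in `U(σ_w, J_w)(E_w)` pulled back
along the continuous one-place model). [cite: Rogawski1990, §3.1 p. 19] [cite: HarishChandra1970, Part I §3] -/
theorem isOpen_setOf_isRegularElt_local_of_nonsplit :
    IsOpen {g : «local» E c N J v | IsRegularElt (g : GL (Fin N) (LocalRing E v))} := by
  have h := ((unitaryGroupOfForm (galAdicCompletionMap (L := E) c hw) (placeForm J w.1)).isOpen_setOf_charpoly_separable).preimage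
    (localNonsplitEquiv c J hc w hw).continuous
  have hset : {g : «local» E c N J v | IsRegularElt (g : GL (Fin N) (LocalRing E v))} =
      (localNonsplitEquiv c J hc w hw) ⁻¹'
        {u : ↥(unitaryGroupOfForm (galAdicCompletionMap (L := E) c hw) (placeForm J w.1)) |
          (((u : GL (Fin N) (w.1.adicCompletion E)) : Matrix (Fin N) (Fin N) (w.1.adicCompletion E)).charpoly).Separable} := by
    ext g
    exact isRegularElt_iff_charpoly_separable_localNonsplitEquiv c N J hc w hw g
  rw [hset]
  exact h

/-- **`t ∈ Z(γ)` regular ⇒ `Z(t) = Z(γ)`** in `U(J)(F_v)` at a non-split place (★ `centralizer_eq_centralizer_of_charpoly_separable` in `U(σ_w, J_w)(E_w) ≤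
GL_N(E_w)` read back along the one-place model, an isomorphism of groups). [cite: Rogawski1990, §3.1 p. 19] -/
theorem centralizer_eq_centralizer_of_isRegularElt_local_of_nonsplit {γ t : «local» E c N J v}
    (hγ : IsRegularElt (γ : GL (Fin N) (LocalRing E v))) (ht : IsRegularElt (t : GL (Fin N) (LocalRing E v)))
    (htγ : t ∈ Subgroup.centralizer ({γ} : Set («local» E c N J v))) :
    Subgroup.centralizer ({t} : Set («local» E c N J v)) = Subgroup.centralizer ({γ} : Set («local» E c N J v)) := by
  have hγ' := (isRegularElt_iff_charpoly_separable_localNonsplitEquiv c N J hc w hw γ).1 hγ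
  have ht' := (isRegularElt_iff_charpoly_separable_localNonsplitEquiv c N J hc w hw t).1 ht
  have htγ' : (localNonsplitEquiv c J hc w hw).toMulEquiv t ∈
      Subgroup.centralizer ({(localNonsplitEquiv c J hc w hw).toMulEquiv γ} :
        Set ↥(unitaryGroupOfForm (galAdicCompletionMap (L := E) c hw) (placeForm J w.1))) :=
    (mulEquiv_apply_mem_centralizer_singleton_iff (localNonsplitEquiv c J hc w hw).toMulEquiv γ t).2 htγ
  have key := centralizer_eq_centralizer_of_charpoly_separable
    (U := unitaryGroupOfForm (galAdicCompletionMap (L := E) c hw) (placeForm J w.1)) hγ' ht' htγ'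
  ext x
  rw [← mulEquiv_apply_mem_centralizer_singleton_iff (localNonsplitEquiv c J hc w hw).toMulEquiv t x,
    ← mulEquiv_apply_mem_centralizer_singleton_iff (localNonsplitEquiv c J hc w hw).toMulEquiv γ x]
  exact Iff.of_eq (congrArg (fun S : Subgroup ↥(unitaryGroupOfForm (galAdicCompletionMap (L := E) c hw) (placeForm J w.1)) =>
    (localNonsplitEquiv c J hc w hw).toMulEquiv x ∈ S) key)

/-! ### §1.2 (ii) Regular orbital integrals are locally constant along the torus -/

variable (hJ : (J.map c)ᵀ = J) (hJd : IsUnit J.det)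

include hJ hJd in
/-- **(ii) TORUS FORM ON `U(J)(F_v)` AT A NON-SPLIT PLACE — REGULAR ORBITAL INTEGRALS OF A CANONICAL FAMILY ARE LOCALLY CONSTANT ALONG THE TORUS, FOR
EVERY LOCALLY CONSTANT COMPACTLY SUPPORTED TEST FUNCTION.** `m` canonical on the regular classes for the Haar `ν` (the currency of ★
`exists_isCanonical_cmDatum_local`), `γ` regular semisimple, `f` locally constant with compact support: there is `W ∈ 𝓝 γ` with `Φ([t], f; m) = Φ([γ], f; m)`
for every `t ∈ W ∩ Z(γ)` (★ generic `…exists_nhds_classOrbitalIntegral_mk_eq_of_isCompact_image_mk_tsupport` at `T = Z(γ)`, `K = Z(γ) ∩ K₁` with `K₁` a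
compact neighbourhood of `γ` inside the open regular locus, the torus measure of ★ `forall_isRegularElt_exists_isHaarMeasure_compactCore_centralizer_local_eq_one`,
§1.1, and Harish-Chandra's uniform compactness ★ `isCompact_image_mk_setOf_exists_conj_mem_local_of_nonsplit` at `C = tsupport f`).
[cite: HarishChandra1970, Part I §3 Lemmas 13–14] [cite: Rogawski1990, §4.3 (4.3.1) p. 43; §4.9 p. 54] [cite: DeitmarEchterhoff2014, Thm. 1.5.3] -/
theorem exists_nhds_classOrbitalIntegral_mk_eq_local_of_nonsplit
    [MeasurableSpace («local» E c N J v)] [BorelSpace («local» E c N J v)]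
    [∀ g : «local» E c N J v, MeasurableSpace («local» E c N J v ⧸ Subgroup.centralizer ({g} : Set («local» E c N J v)))]
    [∀ g : «local» E c N J v, BorelSpace («local» E c N J v ⧸ Subgroup.centralizer ({g} : Set («local» E c N J v)))]
    {ν : Measure («local» E c N J v)} [ν.IsHaarMeasure] [ν.IsMulRightInvariant]
    {m : OrbitalMeasureFamily («local» E c N J v)} (hm : m.IsCanonical (fun g : «local» E c N J v => IsRegularElt (g : GL (Fin N) (LocalRing E v))) ν)
    (γ : «local» E c N J v) (hγ : IsRegularElt (γ : GL (Fin N) (LocalRing E v)))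
    {V : Type*} [NormedAddCommGroup V] [NormedSpace ℝ V] (f : «local» E c N J v → V) (hf : IsLocallyConstant f)
    (hfc : HasCompactSupport f) :
    ∃ W ∈ 𝓝 γ, ∀ t ∈ W, t ∈ Subgroup.centralizer ({γ} : Set («local» E c N J v)) →
      classOrbitalIntegral m f (ConjClasses.mk t) = classOrbitalIntegral m f (ConjClasses.mk γ) := by
  haveI : LocallyCompactSpace (GL (Fin N) (w.1.adicCompletion E)) := locallyCompactSpace_gl_adicCompletion E N w.1
  haveI : SecondCountableTopology (GL (Fin N) (w.1.adicCompletion E)) := secondCountableTopology_gl_adicCompletion E N w.1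
  have hP : ∀ g x : «local» E c N J v, IsRegularElt (g : GL (Fin N) (LocalRing E v)) →
      IsRegularElt ((x * g * x⁻¹ : «local» E c N J v) : GL (Fin N) (LocalRing E v)) := fun g x hg =>
    isRegularElt_of_isConj (isConj_iff.2 ⟨(x : GL (Fin N) (LocalRing E v)), rfl⟩) hg
  have hTc : IsClosed ((Subgroup.centralizer ({γ} : Set («local» E c N J v))) : Set («local» E c N J v)) :=
    isClosed_coe_centralizer_singleton γ
  -- the core-normalised torus measure on `Z(γ)`
  obtain ⟨ρ, hρH, hρi, hρ1⟩ :=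
    forall_isRegularElt_exists_isHaarMeasure_compactCore_centralizer_local_eq_one c N J hc hJ hJd γ hγ
  haveI := hρH
  haveI := hρi
  -- a compact neighbourhood `K₁` of `γ` inside the open regular locus
  obtain ⟨K₁, hK₁c, hγK₁, hK₁R⟩ := exists_compact_subset (isOpen_setOf_isRegularElt_local_of_nonsplit c N J hc w hw) hγ
  have hK₁n : K₁ ∈ 𝓝 γ := mem_interior_iff_mem_nhds.1 hγK₁
  -- the torus box `K = Z(γ) ∩ K₁` and (ii′) at `C = tsupport f`
  have hKc : IsCompact ((Subgroup.centralizer ({γ} : Set («local» E c N J v)) : Set («local» E c N J v)) ∩ K₁) := hK₁c.inter_left hTc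
  have hE := isCompact_image_mk_setOf_exists_conj_mem_local_of_nonsplit c N J hc hJ hJd w hw γ hγ hKc (fun t ht => ht.1)
    (fun t ht => hK₁R ht.2) hfc
  have hγK : γ ∈ (Subgroup.centralizer ({γ} : Set («local» E c N J v)) : Set («local» E c N J v)) ∩ K₁ :=
    ⟨Subgroup.mem_centralizer_singleton_iff.2 rfl, interior_subset hγK₁⟩
  obtain ⟨W, hW, hconcl⟩ := hm.exists_nhds_classOrbitalIntegral_mk_eq_of_isCompact_image_mk_tsupport hP
    (Subgroup.centralizer ({γ} : Set («local» E c N J v))) hTc ρ hρ1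
    (K := (Subgroup.centralizer ({γ} : Set («local» E c N J v)) : Set («local» E c N J v)) ∩ K₁)
    (fun t ht => ⟨hK₁R ht.2, centralizer_eq_centralizer_of_isRegularElt_local_of_nonsplit c N J hc w hw hγ (hK₁R ht.2) ht.1⟩)
    hE hf hγK
  exact ⟨W ∩ K₁, inter_mem hW hK₁n, fun t ht htT => hconcl t ht.1 ⟨htT, ht.2⟩⟩

include hJ hJd in
/-- **Base-point-free reading**: for `γ` regular and ANY regular `t₀ ∈ Z(γ)`, `t ↦ Φ([t], f; m)` is constant on `W ∩ Z(γ)` for some `W ∈ 𝓝 t₀` (§1.2 at the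
base point `t₀`, whose centraliser is `Z(γ)` by §1.1). [cite: HarishChandra1970, Part I §3 Lemmas 13–14] [cite: Rogawski1990, §4.9 p. 54] -/
theorem exists_nhds_classOrbitalIntegral_mk_eq_local_of_nonsplit_of_mem_centralizer
    [MeasurableSpace («local» E c N J v)] [BorelSpace («local» E c N J v)]
    [∀ g : «local» E c N J v, MeasurableSpace («local» E c N J v ⧸ Subgroup.centralizer ({g} : Set («local» E c N J v)))]
    [∀ g : «local» E c N J v, BorelSpace («local» E c N J v ⧸ Subgroup.centralizer ({g} : Set («local» E c N J v)))]
    {ν : Measure («local» E c N J v)} [ν.IsHaarMeasure] [ν.IsMulRightInvariant]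
    {m : OrbitalMeasureFamily («local» E c N J v)} (hm : m.IsCanonical (fun g : «local» E c N J v => IsRegularElt (g : GL (Fin N) (LocalRing E v))) ν)
    {γ t₀ : «local» E c N J v} (hγ : IsRegularElt (γ : GL (Fin N) (LocalRing E v))) (ht₀ : IsRegularElt (t₀ : GL (Fin N) (LocalRing E v)))
    (ht₀γ : t₀ ∈ Subgroup.centralizer ({γ} : Set («local» E c N J v)))
    {V : Type*} [NormedAddCommGroup V] [NormedSpace ℝ V] (f : «local» E c N J v → V) (hf : IsLocallyConstant f)
    (hfc : HasCompactSupport f) :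
    ∃ W ∈ 𝓝 t₀, ∀ t ∈ W, t ∈ Subgroup.centralizer ({γ} : Set («local» E c N J v)) →
      classOrbitalIntegral m f (ConjClasses.mk t) = classOrbitalIntegral m f (ConjClasses.mk t₀) := by
  rw [← centralizer_eq_centralizer_of_isRegularElt_local_of_nonsplit c N J hc w hw hγ ht₀ ht₀γ]
  exact exists_nhds_classOrbitalIntegral_mk_eq_local_of_nonsplit c N J hc w hw hJ hJd hm t₀ ht₀ f hf hfc

include hJ hJd in
/-- **Subspace-topology reading ((G1-i) currency)**: for `ψ ∈ C_c^∞(U(J)(F_v))` (★ `IsLocSmooth`), `γ` regular and a regular point `t₀` of the torus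
`Z(γ)` (as an element of the subgroup type), `Φ(⟦t⟧, ψ; m) = Φ(⟦t₀⟧, ψ; m)` EVENTUALLY for `t → t₀` in `↥Z(γ)` — «`t ↦ Φ(⟦t⟧, ψ)` is locally constant on
`Z(γ)^{reg}`». [cite: HarishChandra1970, Part I §3 Lemmas 13–14] [cite: Rogawski1990, §4.9 p. 54] -/
theorem eventually_classOrbitalIntegral_mk_eq_local_of_nonsplit
    [MeasurableSpace («local» E c N J v)] [BorelSpace («local» E c N J v)]
    [∀ g : «local» E c N J v, MeasurableSpace («local» E c N J v ⧸ Subgroup.centralizer ({g} : Set («local» E c N J v)))]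
    [∀ g : «local» E c N J v, BorelSpace («local» E c N J v ⧸ Subgroup.centralizer ({g} : Set («local» E c N J v)))]
    {ν : Measure («local» E c N J v)} [ν.IsHaarMeasure] [ν.IsMulRightInvariant]
    {m : OrbitalMeasureFamily («local» E c N J v)} (hm : m.IsCanonical (fun g : «local» E c N J v => IsRegularElt (g : GL (Fin N) (LocalRing E v))) ν)
    {γ : «local» E c N J v} (hγ : IsRegularElt (γ : GL (Fin N) (LocalRing E v))) {ψ : «local» E c N J v → ℂ} (hψ : Literature.NumberTheory.Rogawski1990.IsLocSmooth ψ)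
    (t₀ : ↥(Subgroup.centralizer ({γ} : Set («local» E c N J v))))
    (ht₀ : IsRegularElt (((t₀ : «local» E c N J v)) : GL (Fin N) (LocalRing E v))) :
    ∀ᶠ t : ↥(Subgroup.centralizer ({γ} : Set («local» E c N J v))) in 𝓝 t₀,
      classOrbitalIntegral m ψ (ConjClasses.mk (t : «local» E c N J v)) = classOrbitalIntegral m ψ (ConjClasses.mk (t₀ : «local» E c N J v)) := by
  obtain ⟨W, hW, h⟩ := exists_nhds_classOrbitalIntegral_mk_eq_local_of_nonsplit_of_mem_centralizer c N J hc w hw hJ hJd hm hγ ht₀ t₀.2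
    ψ hψ.1 hψ.2
  have hW' : ((↑) : ↥(Subgroup.centralizer ({γ} : Set («local» E c N J v))) → «local» E c N J v) ⁻¹' W ∈ 𝓝 t₀ :=
    (continuous_subtype_val (p := fun x : «local» E c N J v => x ∈ Subgroup.centralizer ({γ} : Set («local» E c N J v)))).continuousAt.preimage_mem_nhds hW
  exact Filter.mem_of_superset hW' fun t ht => h t ht t.2

end Nonsplit

end Literature.NumberTheory.Automorphic.UnitaryGroup

/-! ## §2 The CM spellings on `G′_v = (cmDatum L N J).Local v` -/

namespace Literature.NumberTheory.Rogawski1990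

open Literature.NumberTheory.Automorphic Literature.NumberTheory.Automorphic.UnitaryGroup

section CM

variable (L : Type) [Field L] [NumberField L] [IsCMField L] {N : ℕ} (J : Matrix (Fin N) (Fin N) L)
  (hJ : (J.map (IsCMField.complexConj L))ᵀ = J) (hJd : IsUnit J.det)
  {v : HeightOneSpectrum (𝓞 ↥(maximalRealSubfield L))} (w : UnitaryGroup.PlacesOver L v) (hw : IsCMField.complexConj L • w.1 = w.1)
  [MeasurableSpace ((UnitaryGroup.cmDatum L N J).Local v)] [BorelSpace ((UnitaryGroup.cmDatum L N J).Local v)]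
  [∀ γ : (UnitaryGroup.cmDatum L N J).Local v,
    MeasurableSpace ((UnitaryGroup.cmDatum L N J).Local v ⧸ Subgroup.centralizer ({γ} : Set ((UnitaryGroup.cmDatum L N J).Local v)))]
  [∀ γ : (UnitaryGroup.cmDatum L N J).Local v,
    BorelSpace ((UnitaryGroup.cmDatum L N J).Local v ⧸ Subgroup.centralizer ({γ} : Set ((UnitaryGroup.cmDatum L N J).Local v)))]
  {νG : Measure ((UnitaryGroup.cmDatum L N J).Local v)} [νG.IsHaarMeasure] [νG.IsMulRightInvariant]
  {mG : OrbitalMeasureFamily ((UnitaryGroup.cmDatum L N J).Local v)}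

include hJ hJd w hw

/-- **(ii)-CM TORUS FORM ON `G′_v = (cmDatum L N J).Local v` AT A NON-SPLIT PLACE — REGULAR ORBITAL INTEGRALS OF A CANONICAL FAMILY ARE LOCALLY CONSTANT
ALONG THE TORUS, FOR EVERY LOCALLY CONSTANT COMPACTLY SUPPORTED TEST FUNCTION** (`mG` canonical on the regular classes for `νG`: the currency of ★
`exists_isCanonical_cmDatum_local` ∕ ★ `LocalTransferExplicit` VERBATIM; §1.2 on the carrier — ★ `cmDatum_Local` is `rfl`): for `γ` regular there is
`W ∈ 𝓝 γ` with `Φ(⟦t⟧, f; mG) = Φ(⟦γ⟧, f; mG)` for all `t ∈ W ∩ Z(γ)`. [cite: HarishChandra1970, Part I §3 Lemmas 13–14] [cite: Rogawski1990, §4.3 (4.3.1) p. 43; §4.9 p. 54] -/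
theorem exists_nhds_classOrbitalIntegral_mk_eq_cmDatum_local
    (hmG : mG.IsCanonical (fun γ => IsRegularElt (γ.val : GL (Fin N) (UnitaryGroup.LocalRing L v))) νG)
    (γ : (UnitaryGroup.cmDatum L N J).Local v) (hγ : IsRegularElt (γ.val : GL (Fin N) (UnitaryGroup.LocalRing L v)))
    {V : Type*} [NormedAddCommGroup V] [NormedSpace ℝ V] (f : (UnitaryGroup.cmDatum L N J).Local v → V) (hf : IsLocallyConstant f)
    (hfc : HasCompactSupport f) :
    ∃ W ∈ 𝓝 γ, ∀ t ∈ W, t ∈ Subgroup.centralizer ({γ} : Set ((UnitaryGroup.cmDatum L N J).Local v)) →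
      classOrbitalIntegral mG f (ConjClasses.mk t) = classOrbitalIntegral mG f (ConjClasses.mk γ) := by
  -- the `cmDatum` carrier IS `↥(«local» …)` (★ `cmDatum_Local`, definitional): hand its σ-algebras and Haar instances to the matrix carrier
  letI : MeasurableSpace («local» L (IsCMField.complexConj L) N J v) := ‹MeasurableSpace ((UnitaryGroup.cmDatum L N J).Local v)›
  haveI : BorelSpace («local» L (IsCMField.complexConj L) N J v) := ‹BorelSpace ((UnitaryGroup.cmDatum L N J).Local v)›
  letI : ∀ g : «local» L (IsCMField.complexConj L) N J v, MeasurableSpace («local» L (IsCMField.complexConj L) N J v ⧸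
      Subgroup.centralizer ({g} : Set («local» L (IsCMField.complexConj L) N J v))) :=
    ‹∀ γ : (UnitaryGroup.cmDatum L N J).Local v, MeasurableSpace ((UnitaryGroup.cmDatum L N J).Local v ⧸
      Subgroup.centralizer ({γ} : Set ((UnitaryGroup.cmDatum L N J).Local v)))›
  haveI : ∀ g : «local» L (IsCMField.complexConj L) N J v, BorelSpace («local» L (IsCMField.complexConj L) N J v ⧸
      Subgroup.centralizer ({g} : Set («local» L (IsCMField.complexConj L) N J v))) :=
    ‹∀ γ : (UnitaryGroup.cmDatum L N J).Local v, BorelSpace ((UnitaryGroup.cmDatum L N J).Local v ⧸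
      Subgroup.centralizer ({γ} : Set ((UnitaryGroup.cmDatum L N J).Local v)))›
  haveI : Measure.IsHaarMeasure (G := «local» L (IsCMField.complexConj L) N J v) νG := ‹νG.IsHaarMeasure›
  haveI : Measure.IsMulRightInvariant (G := «local» L (IsCMField.complexConj L) N J v) νG := ‹νG.IsMulRightInvariant›
  exact exists_nhds_classOrbitalIntegral_mk_eq_local_of_nonsplit (IsCMField.complexConj L) N J (IsCMField.complexConj_ne_one L) w hw hJ hJd
    hmG γ hγ f hf hfc

/-- **Base-point-free CM reading**: for `γ` regular and any regular `t₀ ∈ Z(γ)` there is `W ∈ 𝓝 t₀` with `Φ(⟦t⟧, f; mG) = Φ(⟦t₀⟧, f; mG)` for all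
`t ∈ W ∩ Z(γ)`. [cite: HarishChandra1970, Part I §3 Lemmas 13–14] [cite: Rogawski1990, §4.9 p. 54] -/
theorem exists_nhds_classOrbitalIntegral_mk_eq_cmDatum_local_of_mem_centralizer
    (hmG : mG.IsCanonical (fun γ => IsRegularElt (γ.val : GL (Fin N) (UnitaryGroup.LocalRing L v))) νG)
    {γ t₀ : (UnitaryGroup.cmDatum L N J).Local v} (hγ : IsRegularElt (γ.val : GL (Fin N) (UnitaryGroup.LocalRing L v)))
    (ht₀ : IsRegularElt (t₀.val : GL (Fin N) (UnitaryGroup.LocalRing L v)))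
    (ht₀γ : t₀ ∈ Subgroup.centralizer ({γ} : Set ((UnitaryGroup.cmDatum L N J).Local v)))
    {V : Type*} [NormedAddCommGroup V] [NormedSpace ℝ V] (f : (UnitaryGroup.cmDatum L N J).Local v → V) (hf : IsLocallyConstant f)
    (hfc : HasCompactSupport f) :
    ∃ W ∈ 𝓝 t₀, ∀ t ∈ W, t ∈ Subgroup.centralizer ({γ} : Set ((UnitaryGroup.cmDatum L N J).Local v)) →
      classOrbitalIntegral mG f (ConjClasses.mk t) = classOrbitalIntegral mG f (ConjClasses.mk t₀) := by
  letI : MeasurableSpace («local» L (IsCMField.complexConj L) N J v) := ‹MeasurableSpace ((UnitaryGroup.cmDatum L N J).Local v)›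
  haveI : BorelSpace («local» L (IsCMField.complexConj L) N J v) := ‹BorelSpace ((UnitaryGroup.cmDatum L N J).Local v)›
  letI : ∀ g : «local» L (IsCMField.complexConj L) N J v, MeasurableSpace («local» L (IsCMField.complexConj L) N J v ⧸
      Subgroup.centralizer ({g} : Set («local» L (IsCMField.complexConj L) N J v))) :=
    ‹∀ γ : (UnitaryGroup.cmDatum L N J).Local v, MeasurableSpace ((UnitaryGroup.cmDatum L N J).Local v ⧸
      Subgroup.centralizer ({γ} : Set ((UnitaryGroup.cmDatum L N J).Local v)))›
  haveI : ∀ g : «local» L (IsCMField.complexConj L) N J v, BorelSpace («local» L (IsCMField.complexConj L) N J v ⧸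
      Subgroup.centralizer ({g} : Set («local» L (IsCMField.complexConj L) N J v))) :=
    ‹∀ γ : (UnitaryGroup.cmDatum L N J).Local v, BorelSpace ((UnitaryGroup.cmDatum L N J).Local v ⧸
      Subgroup.centralizer ({γ} : Set ((UnitaryGroup.cmDatum L N J).Local v)))›
  haveI : Measure.IsHaarMeasure (G := «local» L (IsCMField.complexConj L) N J v) νG := ‹νG.IsHaarMeasure›
  haveI : Measure.IsMulRightInvariant (G := «local» L (IsCMField.complexConj L) N J v) νG := ‹νG.IsMulRightInvariant›
  exact exists_nhds_classOrbitalIntegral_mk_eq_local_of_nonsplit_of_mem_centralizer (IsCMField.complexConj L) N J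
    (IsCMField.complexConj_ne_one L) w hw hJ hJd hmG hγ ht₀ ht₀γ f hf hfc

/-- **(G1-i) OF THE (HLOC) JUNCTION, TOKEN FORM — `t ↦ Φ(⟦t⟧, ψ; mG)` IS LOCALLY CONSTANT ON THE REGULAR PART OF ANY REGULAR CENTRALISER TORUS
`T = Z(γ)` of `G′_v = (cmDatum L N J).Local v`, in `T`'s subspace topology**: `∀ ψ, IsLocSmooth ψ → ∀ t₀ : ↥(Subgroup.centralizer {γ}), IsRegularElt (t₀ : G′_v).val →
∀ᶠ t in 𝓝 t₀, Φ(⟦t⟧, ψ; mG) = Φ(⟦t₀⟧, ψ; mG)` (F0P2-p02's feeder spec, pulled back there along the torus transport `θ`). [cite: HarishChandra1970, Part I §3 Lemmas 13–14]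
[cite: Rogawski1990, §4.3 (4.3.1) p. 43; §4.9 p. 54] -/
theorem eventually_classOrbitalIntegral_mk_eq_cmDatum_local
    (hmG : mG.IsCanonical (fun γ => IsRegularElt (γ.val : GL (Fin N) (UnitaryGroup.LocalRing L v))) νG)
    {γ : (UnitaryGroup.cmDatum L N J).Local v} (hγ : IsRegularElt (γ.val : GL (Fin N) (UnitaryGroup.LocalRing L v)))
    {ψ : (UnitaryGroup.cmDatum L N J).Local v → ℂ} (hψ : IsLocSmooth ψ)
    (t₀ : ↥(Subgroup.centralizer ({γ} : Set ((UnitaryGroup.cmDatum L N J).Local v))))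
    (ht₀ : IsRegularElt ((t₀ : (UnitaryGroup.cmDatum L N J).Local v).val : GL (Fin N) (UnitaryGroup.LocalRing L v))) :
    ∀ᶠ t : ↥(Subgroup.centralizer ({γ} : Set ((UnitaryGroup.cmDatum L N J).Local v))) in 𝓝 t₀,
      classOrbitalIntegral mG ψ (ConjClasses.mk (t : (UnitaryGroup.cmDatum L N J).Local v)) =
        classOrbitalIntegral mG ψ (ConjClasses.mk (t₀ : (UnitaryGroup.cmDatum L N J).Local v)) := by
  obtain ⟨W, hW, h⟩ := exists_nhds_classOrbitalIntegral_mk_eq_cmDatum_local_of_mem_centralizer L J hJ hJd w hw hmG hγ ht₀ t₀.2 ψ hψ.1 hψ.2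
  have hW' : ((↑) : ↥(Subgroup.centralizer ({γ} : Set ((UnitaryGroup.cmDatum L N J).Local v))) → (UnitaryGroup.cmDatum L N J).Local v) ⁻¹' W ∈ 𝓝 t₀ :=
    (continuous_subtype_val (p := fun x : (UnitaryGroup.cmDatum L N J).Local v =>
      x ∈ Subgroup.centralizer ({γ} : Set ((UnitaryGroup.cmDatum L N J).Local v)))).continuousAt.preimage_mem_nhds hW
  exact Filter.mem_of_superset hW' fun t ht => h t ht t.2

end CM

end Literature.NumberTheory.Rogawski1990

end
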